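import Summits.QuantumFields.BalabanUV.Beta.GAN24.SymBornLambdaContactPairEntry
import Summits.QuantumFields.BalabanUV.Beta.GAN24.CombBornLambdaContactLineage
import Summits.QuantumFields.BalabanUV.Beta.GAN24.CombContactGaugeStaircaseCauchy

/-!
# `BalabanUV.Beta.GAN24.CombBornLambdaContactPairLineage` — binder row G-an2-4 ∕ (CONV-C), TRANSFER-III, the (III′) S-slot (b) of the END, born-Λ contact PAIR `hPc` (road-P2 M.104's
# 4th hypothesis), LEG HALF, PAIR PART 1: **THE WEIGHTED CONTACT ENTRY OF A PAIR OF CONSECUTIVE CONJUGATED Λ LINEAGES `(i+1, i+1+n+1) ∕ (i, i+n+1)` AT an1's SYMMETRISED TABLE,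
# EVERY LETTER A HYPOTHESIS** — the twin of MY g61 `BornLambdaContactPairLineage.abs_weight_mul_contactPair_le_three` with the conjugated legs `T′ = legChain (legComp ψ♭_r ∘ respStepBmSeq ρ_l)`
# (M.59 `combLegChain_sub_respStep`), the conjugated gauge functions `λ′ = Ψ + PsiFace − bmGauge` read as MY g89 `(n+2)`-staircases (`combGauge_eq_staircase ∕ abs_combGaugePiece_le`, born
# alignment `combGauge_succ_sub_eq_staircase ∕ abs_combPieceSucc_le` at rate `θ^{i+n}`) MERGED to depth `n+1` (`CombBornLambdaContactLineage.staircase_merge_top`; letters `A·C₁·X⁻¹`,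
# `A·(c_C θ^{i+n})·X⁻¹`, `A = (1+Lc)(8Lc + F(1+8Lc(e^{κ₁}+1)))`), and the pair socket MY `SymBornLambdaContactPairEntry.abs_contactPair_entry_le`; three in-block roots `r ∕ rl ∕ rt`
# (G-an2-4 CRUX TEAM (2), leaf prover `b2b-balaban-gan24-formalise-leaf-01`, gen 90)

WHAT IS PROVED (`d = 3`, `2 ≤ Lc`; [folklore] bookkeeping + power algebra): `polyA_le'` (the pair's cell polynomial at the letter `A`), **`abs_weight_mul_comb_contactPair_le_three`**
`|W·C′ − W·C| ≤ C_fin·((n+1)·(Lc⁻¹)^{n+1})·θ^{i+n}·e^{−(κ∕12)(‖x−u′‖∞+‖z−u′‖∞)}`, `W = (cE·Lc^8)^{n+1}`, `|cE| ≤ Lc^4`,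
`C_fin = Lc^3·((2·(4!·Lc^4))⁻¹·((4·E2C_sym)·(C₁·(T_Δ·C₁ + 2·T_b·c_C))·(8A + 8A² + 4A·Lc + 12A²·Lc)·Zl 4 (κ∕16)))`.
NOT HERE: the letters and the END `hPc` (`CombBornLambdaContactDrift`).

NOT IN PRINT; OUR BOOKKEEPING ([folklore]; 0 `def`, 0 cited fact, 0 `def … : Prop`, 0 sorry; `set_option maxHeartbeats 1600000 in` on the one count — the `ring` reassociations of the
displayed constant).  HONEST FRAMING (cell contract, verbatim): «discharging `BetaPertH` makes Bałaban's UV stability UNCONDITIONAL — a real constructive-QFT result; it is NOT the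
continuum limit and NOT the Clay problem.»  HONEST DEPENDENCY (verbatim): «continuum YM on T⁴ ⇐ BetaPertH ∧ nine spine estimates (0/9 proved); BetaPertH ⇐ (D1) ∧ (D4) ∧ CAP+tail;
G-an2-4 gates asym, D1 and NE2/3/4.»  Discharges NO letter of M.104 by itself; NEVER «G-an2-4 closed» as (CONV-C); NOT D1, NOT `BetaPertH`, NOT continuum, NOT Clay.  2026-08-28.
-/

noncomputable section

open Finset
open scoped BigOperators
open Literature.MathematicalPhysics.QuantumFieldTheory
open Literature.MathematicalPhysics.QuantumFieldTheory.LatticeForm (quo)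
open Literature.MathematicalPhysics.QuantumFieldTheory.Balaban1983to89
open Literature.MathematicalPhysics.QuantumFieldTheory.Balaban1983to89.Beta
open B4ContourShift (supNorm supNorm_nonneg)
open B12Sec2to5 (l1 l1_nonneg)
open ExpKernelCalculus (MKer Zl Zl_nonneg)
open AffineAveraging (Form0 Form1 Site box toSite unitVec dz)
open AveragingContours (blk)
open AveragingHessianKernels (ell)
open OneStepResolventKernel (Fib)
open InterLevelTransport (SLam)
open KernelWard (divV)
open KKTFluctuationKernel (delta1)
open BalabanCompositeJets (respStep)
open Summit.QuantumFields.BalabanUV.Beta.AxialProjectorBlockMean (bmGaugeAt)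
open Summit.QuantumFields.BalabanUV.Beta.SymCorrectorKernel (psiKS)
open Summit.QuantumFields.BalabanUV.Beta.SymCorrectorForms (zetaS)
open Summit.QuantumFields.BalabanUV.Beta.SymCorrectorFace (faceWtSum faceWtSum_nonneg)
open Summit.QuantumFields.BalabanUV.Beta.SymAveragingHessianCounts (symHessFFAt)
open Summit.QuantumFields.BalabanUV.Beta.GAN24.RespStepBmDecompLegs (legAct)
open Summit.QuantumFields.BalabanUV.Beta.GAN24.RespStepBmDecompPsi (Psi)
open Summit.QuantumFields.BalabanUV.Beta.GAN24.RespStepBmDecompExact (respStepBmSeq blk_blk_pow)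
open Summit.QuantumFields.BalabanUV.Beta.GAN24.Push4 (legComp)
open Summit.QuantumFields.BalabanUV.Beta.GAN24.Push4Iter (legChain)
open Summit.QuantumFields.BalabanUV.Beta.GAN24.Push3 (push₃ isFF_push₃)
open Summit.QuantumFields.BalabanUV.Beta.GAN24.Push3LegTelescope (abs_le_of_env' summable_of_env')
open Summit.QuantumFields.BalabanUV.Beta.GAN24.CombLegChainGauge (PsiFace)
open Summit.QuantumFields.BalabanUV.Beta.GAN24.CombContactGaugeStaircase (combGauge_eq_staircase abs_combGaugePiece_le)
open Summit.QuantumFields.BalabanUV.Beta.GAN24.CombContactGaugeStaircaseCauchy (combGauge_succ_sub_eq_staircase abs_combPieceSucc_le)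
open Summit.QuantumFields.BalabanUV.Beta.GAN24.CombContactKernelCells (combLegChain_sub_respStep)
open Summit.QuantumFields.BalabanUV.Beta.GAN24.ContactLambdaCellBound (exp_env_mono_rate)
open Summit.QuantumFields.BalabanUV.Beta.GAN24.SymBornLambdaContactPairEntry (abs_contactPair_entry_le)
open Summit.QuantumFields.BalabanUV.Beta.GAN24.BornLambdaContactLineage (units_le)
open Summit.QuantumFields.BalabanUV.Beta.GAN24.CombBornLambdaContactLineage (staircase_merge_top)
open Summit.QuantumFields.BalabanUV.Beta.GAN24.UndressedResponseUnits (inv_cast_pow_pow)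

namespace Summit.QuantumFields.BalabanUV.Beta.GAN24.CombBornLambdaContactPairLineage

variable {Lc : ℕ} [NeZero Lc]

/-! ## §1 The pair's cell polynomial at the gauge letter `A` -/

omit [NeZero Lc] in
/-- [folklore] `8A + 8A² + (4A·Lc + 12A²·Lc)·n ≤ (n+1)·(8A + 8A² + 4A·Lc + 12A²·Lc)` (`A, Lc ≥ 0`). -/
theorem polyA_le' {A : ℝ} (hA : 0 ≤ A) (n : ℕ) :
    8 * A + 8 * A ^ 2 + (4 * A * Lc + 12 * A ^ 2 * Lc) * n
      ≤ ((n : ℝ) + 1) * (8 * A + 8 * A ^ 2 + 4 * A * Lc + 12 * A ^ 2 * Lc) := by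
  have hL : (0 : ℝ) ≤ (Lc : ℝ) := Nat.cast_nonneg _
  have hn : (0 : ℝ) ≤ n := Nat.cast_nonneg _
  have h1 : 0 ≤ 8 * A + 8 * A ^ 2 := by positivity
  have h2 : 0 ≤ 4 * A * Lc + 12 * A ^ 2 * Lc := by positivity
  nlinarith [mul_nonneg h1 hn, mul_nonneg h2 hn]

/-! ## §2 The weighted contact entry of a PAIR of consecutive conjugated Λ lineages, every letter a hypothesis -/

section Pair

variable {r rl rt : Fin (3 + 1) → ℕ} {i n : ℕ} {cE : ℝ} {C₁ cC θ κ₁ KE κE Clam Cc' δc' Cc δc Tb TΔ δK F : ℝ}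
  {c' c : Fin (3 + 1) → (Fin (3 + 1) → ℤ) → Fin (3 + 1) → (Fin (3 + 1) → ℤ) → ℝ}

set_option maxHeartbeats 1600000 in
/-- NOT IN PRINT; OUR PROOF.  **THE WEIGHTED CONTACT ENTRY OF THE PAIR `(i+1, i+1+n+1) ∕ (i, i+n+1)` OF CONJUGATED Λ LINEAGES AT THE SYM TABLE** (`d = 3`, `2 ≤ Lc`, in-block roots `r`
(corrector), `rl` (dressing), `rt` (table); chain length `n` for both; legs `T′ = legChain (legComp ψ♭_r ∘ respStepBmSeq ρ_l) (i+1) n`, `B′ = respStep (Lc^(i+1)) (Lc^(i+1+n+1))`,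
`T = … i n`, `B = respStep (Lc^i) (Lc^(i+n+1))`; coefficient families `c′`, `c`): under (N1) `(C₁, κ₁)`, CT-4a `(c_C, θ, κ₁)` (same rate), the conjugated envelope `(K_E, κ_E)` and the
gauge sup `C_λ` (both uniform in the birth level), the face letter `F ≥ faceWtSum r Lc`, the coefficients' decays and transversality AT THE SYM TABLE, the two bracket letters
`T_b·((Lc^n)^7)⁻¹·e^{−δ_K‖·‖}` and the bracket PAIR letter `T_Δ·θ^{i+n}·((Lc^n)^7)⁻¹·e^{−δ_K‖·‖}` for the conjugated legs, the weight pin `|cE| ≤ Lc^4`; with `κ = min δ_K κ₁`, for ALL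
`κ′ u′ x z a b`: `|W·C′ − W·C| ≤ C_fin·((n+1)·(Lc⁻¹)^{n+1})·θ^{i+n}·e^{−(κ∕12)(‖x−u′‖∞+‖z−u′‖∞)}` (MY (E) count, structure verbatim, at the merged comb staircases). -/
theorem abs_weight_mul_comb_contactPair_le_three (hLc : 2 ≤ Lc) (hr : r ∈ box (3 + 1) Lc) (hrl : rl ∈ box (3 + 1) Lc) (hrt : rt ∈ box (3 + 1) Lc)
    (hcE : |cE| ≤ (Lc : ℝ) ^ 4)
    (hN1 : ∀ (m k : ℕ) (μ : Fin (3 + 1)) (z : Site (3 + 1)) (l'' : Fin (3 + 1)) (w' : Site (3 + 1)),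
      |respStep (d := 3) (Lc ^ m) (Lc ^ (m + k + 1)) μ z l'' w'| ≤
        C₁ * ((Lc : ℝ) ^ (5 * (k + 1)))⁻¹ * Real.exp (-(κ₁ * supNorm (quo (Lc ^ (k + 1)) w' - z))))
    (hCau : ∀ (s k : ℕ) (μ : Fin (3 + 1)) (z : Site (3 + 1)) (l : Fin (3 + 1)) (w : Site (3 + 1)),
      |respStep (d := 3) (Lc ^ (s + 1)) (Lc ^ (s + k + 2)) μ z l w - respStep (d := 3) (Lc ^ s) (Lc ^ (s + k + 1)) μ z l w|
        ≤ cC * θ ^ (s + k) * ((((Lc ^ (k + 1) : ℕ) : ℝ)) ^ (3 + 2))⁻¹ * Real.exp (-(κ₁ * supNorm (quo (Lc ^ (k + 1)) w - z))))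
    (hκ₁ : 0 < κ₁) (hC₁ : 0 ≤ C₁) (hcC : 0 ≤ cC) (hθ : 0 ≤ θ) (hF : faceWtSum r Lc ≤ F)
    (hE : ∀ m μ z l u, |legChain (fun j => legComp (fun α x κ u => psiKS r Lc u x (Sum.inl κ) (Sum.inl α)) (respStepBmSeq (d := 3) (toSite rl) Lc j)) m n μ z l u|
      ≤ KE * Real.exp (-(κE * supNorm (quo (Lc ^ (n + 1)) u - z))))
    (hκE : 0 < κE)
    (hlam : ∀ m μ z u, |(Psi (toSite rl) Lc m n (delta1 μ z) + PsiFace r (toSite rl) Lc m n (delta1 μ z)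
        - bmGaugeAt (toSite rl) (respStep (d := 3) (Lc ^ m) (Lc ^ (m + n + 1)) μ z) Lc) u| ≤ Clam)
    (hc' : ∀ μ y l u, |c' μ y l u| ≤ Cc' * Real.exp (-δc' * l1 ((Lc : ℤ) • y - u))) (hδc' : 0 < δc') (hCc' : 0 ≤ Cc')
    (hdiv' : ∀ u, divV (SLam Lc c' (fun μ y => symHessFFAt (toSite rt) Lc μ y)) u = 0)
    (hc : ∀ μ y l u, |c μ y l u| ≤ Cc * Real.exp (-δc * l1 ((Lc : ℤ) • y - u))) (hδc : 0 < δc) (hCc : 0 ≤ Cc)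
    (hdiv : ∀ u, divV (SLam Lc c (fun μ y => symHessFFAt (toSite rt) Lc μ y)) u = 0)
    (hbr' : ∀ (κ' : Fin (3 + 1)) (u' : Site (3 + 1)) μ y, |∑' u, ∑ l, legChain (fun j => legComp (fun α x κ u => psiKS r Lc u x (Sum.inl κ) (Sum.inl α)) (respStepBmSeq (d := 3) (toSite rl) Lc j)) (i + 1) n κ' u' l u * c' μ y l u|
      ≤ Tb * ((((Lc : ℝ) ^ n) ^ (2 * 3 + 1))⁻¹) * Real.exp (-(δK * supNorm (quo (Lc ^ n) y - u'))))
    (hbr : ∀ (κ' : Fin (3 + 1)) (u' : Site (3 + 1)) μ y, |∑' u, ∑ l, legChain (fun j => legComp (fun α x κ u => psiKS r Lc u x (Sum.inl κ) (Sum.inl α)) (respStepBmSeq (d := 3) (toSite rl) Lc j)) i n κ' u' l u * c μ y l u|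
      ≤ Tb * ((((Lc : ℝ) ^ n) ^ (2 * 3 + 1))⁻¹) * Real.exp (-(δK * supNorm (quo (Lc ^ n) y - u'))))
    (hbrΔ : ∀ (κ' : Fin (3 + 1)) (u' : Site (3 + 1)) μ y,
      |(∑' u, ∑ l, legChain (fun j => legComp (fun α x κ u => psiKS r Lc u x (Sum.inl κ) (Sum.inl α)) (respStepBmSeq (d := 3) (toSite rl) Lc j)) (i + 1) n κ' u' l u * c' μ y l u)
          - ∑' u, ∑ l, legChain (fun j => legComp (fun α x κ u => psiKS r Lc u x (Sum.inl κ) (Sum.inl α)) (respStepBmSeq (d := 3) (toSite rl) Lc j)) i n κ' u' l u * c μ y l u|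
        ≤ TΔ * θ ^ (i + n) * ((((Lc : ℝ) ^ n) ^ (2 * 3 + 1))⁻¹) * Real.exp (-(δK * supNorm (quo (Lc ^ n) y - u'))))
    (hδK : 0 < δK) (hTb : 0 ≤ Tb) (hTΔ : 0 ≤ TΔ)
    (κ' : Fin (3 + 1)) (u' x z : Site (3 + 1)) (a b : Fib 3) :
    |(cE * (Lc : ℝ) ^ (2 * (3 + 1))) ^ (n + 1) *
        (push₃ (legChain (fun j => legComp (fun α x κ u => psiKS r Lc u x (Sum.inl κ) (Sum.inl α)) (respStepBmSeq (d := 3) (toSite rl) Lc j)) (i + 1) n) (legChain (fun j => legComp (fun α x κ u => psiKS r Lc u x (Sum.inl κ) (Sum.inl α)) (respStepBmSeq (d := 3) (toSite rl) Lc j)) (i + 1) n)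
            (legChain (fun j => legComp (fun α x κ u => psiKS r Lc u x (Sum.inl κ) (Sum.inl α)) (respStepBmSeq (d := 3) (toSite rl) Lc j)) (i + 1) n) (SLam Lc c' (fun μ y => symHessFFAt (toSite rt) Lc μ y)) κ' u' x z a b
          - push₃ (respStep (d := 3) (Lc ^ (i + 1)) (Lc ^ (i + 1 + n + 1))) (respStep (d := 3) (Lc ^ (i + 1)) (Lc ^ (i + 1 + n + 1)))
            (respStep (d := 3) (Lc ^ (i + 1)) (Lc ^ (i + 1 + n + 1))) (SLam Lc c' (fun μ y => symHessFFAt (toSite rt) Lc μ y)) κ' u' x z a b)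
      - (cE * (Lc : ℝ) ^ (2 * (3 + 1))) ^ (n + 1) *
        (push₃ (legChain (fun j => legComp (fun α x κ u => psiKS r Lc u x (Sum.inl κ) (Sum.inl α)) (respStepBmSeq (d := 3) (toSite rl) Lc j)) i n) (legChain (fun j => legComp (fun α x κ u => psiKS r Lc u x (Sum.inl κ) (Sum.inl α)) (respStepBmSeq (d := 3) (toSite rl) Lc j)) i n)
            (legChain (fun j => legComp (fun α x κ u => psiKS r Lc u x (Sum.inl κ) (Sum.inl α)) (respStepBmSeq (d := 3) (toSite rl) Lc j)) i n) (SLam Lc c (fun μ y => symHessFFAt (toSite rt) Lc μ y)) κ' u' x z a b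
          - push₃ (respStep (d := 3) (Lc ^ i) (Lc ^ (i + n + 1))) (respStep (d := 3) (Lc ^ i) (Lc ^ (i + n + 1)))
            (respStep (d := 3) (Lc ^ i) (Lc ^ (i + n + 1))) (SLam Lc c (fun μ y => symHessFFAt (toSite rt) Lc μ y)) κ' u' x z a b)|
      ≤ ((Lc : ℝ) ^ 3 * ((2 * ((((3 + 1).factorial : ℕ) : ℝ) * (Lc : ℝ) ^ (3 + 1)))⁻¹ * ((((3 : ℝ) + 1) * (Real.exp (2 * ((3 : ℝ) + 1) * min δK κ₁) ^ 2 *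
              (((2 * Lc : ℕ) : ℝ) ^ (3 + 1) * (((3 + 1 : ℕ) : ℝ) * ((((3 + 1).factorial : ℕ) : ℝ) * ((Lc : ℝ) ^ (3 + 1) * (ell (3 + 1) Lc : ℝ))))))))
            * (C₁ * (TΔ * C₁ + 2 * Tb * cC)) * (8 * ((1 + (Lc : ℝ)) * (8 * (Lc : ℝ) + F * (1 + 8 * (Lc : ℝ) * (Real.exp κ₁ + 1)))) + 8 * ((1 + (Lc : ℝ)) * (8 * (Lc : ℝ) + F * (1 + 8 * (Lc : ℝ) * (Real.exp κ₁ + 1)))) ^ 2 + 4 * ((1 + (Lc : ℝ)) * (8 * (Lc : ℝ) + F * (1 + 8 * (Lc : ℝ) * (Real.exp κ₁ + 1)))) * Lc + 12 * ((1 + (Lc : ℝ)) * (8 * (Lc : ℝ) + F * (1 + 8 * (Lc : ℝ) * (Real.exp κ₁ + 1)))) ^ 2 * Lc) * Zl (3 + 1) (min δK κ₁ / (4 * ((3 : ℝ) + 1)))))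
          * ((((n : ℝ) + 1)) * ((Lc : ℝ)⁻¹) ^ (n + 1)) * θ ^ (i + n)
          * Real.exp (-(min δK κ₁ / 12) * (supNorm (x - u') + supNorm (z - u'))) := by
  have hLc1 : 1 ≤ Lc := le_trans (by norm_num) hLc
  have hL : (0 : ℝ) < (Lc : ℝ) := Nat.cast_pos.2 (Nat.pos_of_ne_zero (NeZero.ne Lc))
  have hLn1 : 1 ≤ Lc ^ (n + 1) := Nat.one_le_pow _ _ hLc1
  have hκ : 0 < min δK κ₁ := lt_min hδK hκ₁
  have hκK : min δK κ₁ ≤ δK := min_le_left _ _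
  have hκ1 : min δK κ₁ ≤ κ₁ := min_le_right _ _
  have hθp : 0 ≤ θ ^ (i + n) := pow_nonneg hθ _
  -- the legs
  set T' := legChain (fun j => legComp (fun α x κ u => psiKS r Lc u x (Sum.inl κ) (Sum.inl α)) (respStepBmSeq (d := 3) (toSite rl) Lc j)) (i + 1) n with hT'def
  set B' := respStep (d := 3) (Lc ^ (i + 1)) (Lc ^ (i + 1 + n + 1)) with hB'def
  set T := legChain (fun j => legComp (fun α x κ u => psiKS r Lc u x (Sum.inl κ) (Sum.inl α)) (respStepBmSeq (d := 3) (toSite rl) Lc j)) i n with hTdef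
  set B := respStep (d := 3) (Lc ^ i) (Lc ^ (i + n + 1)) with hBdef
  have hT' : ∀ μ z' l u, |T' μ z' l u| ≤ KE := abs_le_of_env' hκE.le (hE (i + 1))
  have hTs' : ∀ μ z' l, Summable fun u => T' μ z' l u := summable_of_env' hLn1 hκE (hE (i + 1))
  have hT : ∀ μ z' l u, |T μ z' l u| ≤ KE := abs_le_of_env' hκE.le (hE i)
  have hTs : ∀ μ z' l, Summable fun u => T μ z' l u := summable_of_env' hLn1 hκE (hE i)
  have hBn' : ∀ μ z' l u, |B' μ z' l u| ≤ C₁ * ((Lc : ℝ) ^ (5 * (n + 1)))⁻¹ * Real.exp (-(min δK κ₁ * supNorm (quo (Lc ^ (n + 1)) u - z'))) := by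
    intro μ z' l u
    exact (hN1 (i + 1) n μ z' l u).trans (mul_le_mul_of_nonneg_left (exp_env_mono_rate hκ1 (supNorm_nonneg _)) (by positivity))
  have hBn : ∀ μ z' l u, |B μ z' l u| ≤ C₁ * ((Lc : ℝ) ^ (5 * (n + 1)))⁻¹ * Real.exp (-(min δK κ₁ * supNorm (quo (Lc ^ (n + 1)) u - z'))) := by
    intro μ z' l u
    exact (hN1 i n μ z' l u).trans (mul_le_mul_of_nonneg_left (exp_env_mono_rate hκ1 (supNorm_nonneg _)) (by positivity))
  have hBΔ : ∀ μ z' l u, |B' μ z' l u - B μ z' l u|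
      ≤ (cC * θ ^ (i + n) * ((Lc : ℝ) ^ (5 * (n + 1)))⁻¹) * Real.exp (-(min δK κ₁ * supNorm (quo (Lc ^ (n + 1)) u - z'))) := by
    intro μ z' l u
    have h := hCau i n μ z' l u
    rw [show i + n + 2 = i + 1 + n + 1 by omega, inv_cast_pow_pow, show (3 + 2) * (n + 1) = 5 * (n + 1) by norm_num] at h
    exact h.trans (mul_le_mul_of_nonneg_left (exp_env_mono_rate hκ1 (supNorm_nonneg _)) (by positivity))
  -- the gauge functions, their staircases and pieces
  -- the conjugated bond gauge functions of the two towers, their MERGED staircases and pieces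
  set A : ℝ := (1 + (Lc : ℝ)) * (8 * (Lc : ℝ) + F * (1 + 8 * (Lc : ℝ) * (Real.exp κ₁ + 1))) with hAdef
  have hF0 : 0 ≤ F := (faceWtSum_nonneg r Lc).trans hF
  have hA0 : 0 ≤ A := by positivity
  obtain ⟨lam', hlam'def⟩ : ∃ f : Fin (3 + 1) → Site (3 + 1) → Site (3 + 1) → ℝ, f = fun μ z' =>
      Psi (toSite rl) Lc (i + 1) n (delta1 μ z') + PsiFace r (toSite rl) Lc (i + 1) n (delta1 μ z')
        - bmGaugeAt (toSite rl) (respStep (d := 3) (Lc ^ (i + 1)) (Lc ^ (i + 1 + n + 1)) μ z') Lc := ⟨_, rfl⟩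
  obtain ⟨lam, hlamdef⟩ : ∃ f : Fin (3 + 1) → Site (3 + 1) → Site (3 + 1) → ℝ, f = fun μ z' =>
      Psi (toSite rl) Lc i n (delta1 μ z') + PsiFace r (toSite rl) Lc i n (delta1 μ z')
        - bmGaugeAt (toSite rl) (respStep (d := 3) (Lc ^ i) (Lc ^ (i + n + 1)) μ z') Lc := ⟨_, rfl⟩
  -- the raw `(n+2)`-staircase piece families of MY g89 (`combGauge_eq_staircase`, `combGauge_succ_sub_eq_staircase`) at base `i+1` ∕ `i`
  obtain ⟨G1', hG1'def⟩ : ∃ G : Fin (3 + 1) → Site (3 + 1) → ℕ → Site (3 + 1) → ℝ, G = fun μ₀ z₀ s y =>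
      (if s ≤ n then
          (if s = 0 then -bmGaugeAt (toSite rl) (respStep (d := 3) (Lc ^ (i + 1)) (Lc ^ (i + 1 + n + 1)) μ₀ z₀) Lc y
           else -(((Lc : ℝ) ^ ((3 + 1) * s))⁻¹ *
             bmGaugeAt (toSite rl) (legAct (respStep (d := 3) (Lc ^ (i + 1 + s)) (Lc ^ (i + 1 + n + 1))) (delta1 μ₀ z₀)) Lc y))
        else 0)
      + (if s = 0 then 0
         else ((Lc : ℝ) ^ ((3 + 1) * (s - 1)))⁻¹ * ((((box (3 + 1) Lc).card : ℝ))⁻¹ *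
           zetaS (toSite r) Lc (legAct (legChain (respStepBmSeq (d := 3) (toSite rl) Lc) (i + 1 + (s - 1)) (n - (s - 1))) (delta1 μ₀ z₀)) y)) := ⟨_, rfl⟩
  obtain ⟨G1, hG1def⟩ : ∃ G : Fin (3 + 1) → Site (3 + 1) → ℕ → Site (3 + 1) → ℝ, G = fun μ₀ z₀ s y =>
      (if s ≤ n then
          (if s = 0 then -bmGaugeAt (toSite rl) (respStep (d := 3) (Lc ^ i) (Lc ^ (i + n + 1)) μ₀ z₀) Lc y
           else -(((Lc : ℝ) ^ ((3 + 1) * s))⁻¹ *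
             bmGaugeAt (toSite rl) (legAct (respStep (d := 3) (Lc ^ (i + s)) (Lc ^ (i + n + 1))) (delta1 μ₀ z₀)) Lc y))
        else 0)
      + (if s = 0 then 0
         else ((Lc : ℝ) ^ ((3 + 1) * (s - 1)))⁻¹ * ((((box (3 + 1) Lc).card : ℝ))⁻¹ *
           zetaS (toSite r) Lc (legAct (legChain (respStepBmSeq (d := 3) (toSite rl) Lc) (i + (s - 1)) (n - (s - 1))) (delta1 μ₀ z₀)) y)) := ⟨_, rfl⟩
  obtain ⟨D1, hD1def⟩ : ∃ G : Fin (3 + 1) → Site (3 + 1) → ℕ → Site (3 + 1) → ℝ, G = fun μ₀ z₀ s y =>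
      (if s ≤ n then
        -(((Lc : ℝ) ^ ((3 + 1) * s))⁻¹ *
          bmGaugeAt (toSite rl) (legAct (respStep (d := 3) (Lc ^ (i + 1 + s)) (Lc ^ (i + 1 + n + 1))) (delta1 μ₀ z₀)
            - legAct (respStep (d := 3) (Lc ^ (i + s)) (Lc ^ (i + n + 1))) (delta1 μ₀ z₀)) Lc y)
       else 0)
      + (if s = 0 then (0 : ℝ)
         else ((Lc : ℝ) ^ ((3 + 1) * (s - 1)))⁻¹ * ((((box (3 + 1) Lc).card : ℝ))⁻¹ *
           (zetaS (toSite r) Lc (legAct (legChain (respStepBmSeq (d := 3) (toSite rl) Lc) (i + 1 + (s - 1)) (n - (s - 1))) (delta1 μ₀ z₀)) y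
            - zetaS (toSite r) Lc (legAct (legChain (respStepBmSeq (d := 3) (toSite rl) Lc) (i + (s - 1)) (n - (s - 1))) (delta1 μ₀ z₀)) y))) := ⟨_, rfl⟩
  -- merged to depth `n+1`
  obtain ⟨Gp', hGp'def⟩ : ∃ G : Fin (3 + 1) → Site (3 + 1) → ℕ → Site (3 + 1) → ℝ, G = fun μ₀ z₀ s y =>
      G1' μ₀ z₀ s y + (if s = n then G1' μ₀ z₀ (n + 1) (blk Lc y) else 0) := ⟨_, rfl⟩
  obtain ⟨Gp, hGpdef⟩ : ∃ G : Fin (3 + 1) → Site (3 + 1) → ℕ → Site (3 + 1) → ℝ, G = fun μ₀ z₀ s y =>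
      G1 μ₀ z₀ s y + (if s = n then G1 μ₀ z₀ (n + 1) (blk Lc y) else 0) := ⟨_, rfl⟩
  obtain ⟨GΔ, hGΔdef⟩ : ∃ G : Fin (3 + 1) → Site (3 + 1) → ℕ → Site (3 + 1) → ℝ, G = fun μ₀ z₀ s y =>
      D1 μ₀ z₀ s y + (if s = n then D1 μ₀ z₀ (n + 1) (blk Lc y) else 0) := ⟨_, rfl⟩
  have hTB' : T' - B' = fun μ z' l u => dz (lam' μ z') l u := by
    rw [hlam'def]; exact combLegChain_sub_respStep (d := 3) hr hrl (i + 1) n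
  have hTB : T - B = fun μ z' l u => dz (lam μ z') l u := by
    rw [hlamdef]; exact combLegChain_sub_respStep (d := 3) hr hrl i n
  have hlamB' : ∀ μ z' u, |lam' μ z' u| ≤ Clam := fun μ z' u => by rw [hlam'def]; exact hlam (i + 1) μ z' u
  have hlamB : ∀ μ z' u, |lam μ z' u| ≤ Clam := fun μ z' u => by rw [hlamdef]; exact hlam i μ z' u
  have hψ' : ∀ (μ₀ : Fin (3 + 1)) (z₀ u : Site (3 + 1)), lam' μ₀ z₀ u = ∑ s ∈ Finset.range (n + 1), Gp' μ₀ z₀ s (blk (Lc ^ s) u) := by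
    intro μ₀ z₀ u
    have h : lam' μ₀ z₀ u = ∑ s ∈ Finset.range (n + 1 + 1), G1' μ₀ z₀ s (blk (Lc ^ s) u) := by
      rw [hlam'def, hG1'def]; exact combGauge_eq_staircase (Lc := Lc) r (toSite rl) (i + 1) n μ₀ z₀ u
    rw [h, staircase_merge_top, hGp'def]
  have hψ : ∀ (μ₀ : Fin (3 + 1)) (z₀ u : Site (3 + 1)), lam μ₀ z₀ u = ∑ s ∈ Finset.range (n + 1), Gp μ₀ z₀ s (blk (Lc ^ s) u) := by
    intro μ₀ z₀ u
    have h : lam μ₀ z₀ u = ∑ s ∈ Finset.range (n + 1 + 1), G1 μ₀ z₀ s (blk (Lc ^ s) u) := by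
      rw [hlamdef, hG1def]; exact combGauge_eq_staircase (Lc := Lc) r (toSite rl) i n μ₀ z₀ u
    rw [h, staircase_merge_top, hGpdef]
  have hψΔ : ∀ (μ₀ : Fin (3 + 1)) (z₀ u : Site (3 + 1)), lam' μ₀ z₀ u - lam μ₀ z₀ u = ∑ s ∈ Finset.range (n + 1), GΔ μ₀ z₀ s (blk (Lc ^ s) u) := by
    intro μ₀ z₀ u
    have h : lam' μ₀ z₀ u - lam μ₀ z₀ u = ∑ s ∈ Finset.range (n + 1 + 1), D1 μ₀ z₀ s (blk (Lc ^ s) u) := by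
      rw [hlam'def, hlamdef, hD1def]; exact combGauge_succ_sub_eq_staircase (Lc := Lc) r (toSite rl) i n μ₀ z₀ u
    rw [h, staircase_merge_top, hGΔdef]
  -- the merged piece letters: `α₁(1+Lc) = A·C₁·X⁻¹` for both towers, `A·(c_C θ^{i+n})·X⁻¹` for the difference
  have hmerge : ∀ (G : Fin (3 + 1) → Site (3 + 1) → ℕ → Site (3 + 1) → ℝ) (α : ℝ) (μ₀ : Fin (3 + 1)) (z₀ : Site (3 + 1)), 0 ≤ α →
      (∀ s, s ≤ n + 1 → ∀ y : Site (3 + 1), |G μ₀ z₀ s (blk (Lc ^ s) y)| ≤ α * (Lc : ℝ) ^ s * Real.exp (-(κ₁ * supNorm (quo (Lc ^ (n + 1)) y - z₀)))) →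
      ∀ s, s ≤ n → ∀ u : Site (3 + 1), |G μ₀ z₀ s (blk (Lc ^ s) u) + (if s = n then G μ₀ z₀ (n + 1) (blk Lc (blk (Lc ^ s) u)) else 0)|
        ≤ ((1 + (Lc : ℝ)) * α) * (Lc : ℝ) ^ s * Real.exp (-(min δK κ₁ * supNorm (quo (Lc ^ (n + 1)) u - z₀))) := by
    intro G α μ₀ z₀ hα hGraw s hs u
    set E₁ : ℝ := Real.exp (-(κ₁ * supNorm (quo (Lc ^ (n + 1)) u - z₀))) with hE₁
    have hmono : E₁ ≤ Real.exp (-(min δK κ₁ * supNorm (quo (Lc ^ (n + 1)) u - z₀))) := exp_env_mono_rate hκ1 (supNorm_nonneg _)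
    have h1 : |G μ₀ z₀ s (blk (Lc ^ s) u)| ≤ α * (Lc : ℝ) ^ s * E₁ := hGraw s (by omega) u
    have h2 : |(if s = n then G μ₀ z₀ (n + 1) (blk Lc (blk (Lc ^ s) u)) else 0)| ≤ α * (Lc : ℝ) ^ (s + 1) * E₁ := by
      split_ifs with hsn
      · subst hsn
        rw [blk_blk_pow]
        exact hGraw (s + 1) le_rfl u
      · rw [abs_zero]; positivity
    calc _ ≤ α * (Lc : ℝ) ^ s * E₁ + α * (Lc : ℝ) ^ (s + 1) * E₁ := (abs_add_le _ _).trans (add_le_add h1 h2)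
      _ = ((1 + (Lc : ℝ)) * α) * (Lc : ℝ) ^ s * E₁ := by ring
      _ ≤ _ := mul_le_mul_of_nonneg_left hmono (by positivity)
  have eA1 : (1 + (Lc : ℝ)) * (8 * (Lc : ℝ) * C₁ * ((Lc : ℝ) ^ (5 * (n + 1)))⁻¹ + F * ((1 + 8 * (Lc : ℝ) * (Real.exp κ₁ + 1)) * C₁ * ((Lc : ℝ) ^ (5 * (n + 1)))⁻¹))
      = A * C₁ * ((Lc : ℝ) ^ (5 * (n + 1)))⁻¹ := by rw [hAdef]; ring
  have eAΔ : (1 + (Lc : ℝ)) * ((8 * (Lc : ℝ) + F * (1 + 8 * (Lc : ℝ) * (Real.exp κ₁ + 1))) * (cC * θ ^ (i + n)) * ((Lc : ℝ) ^ (5 * (n + 1)))⁻¹)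
      = A * (cC * θ ^ (i + n)) * ((Lc : ℝ) ^ (5 * (n + 1)))⁻¹ := by rw [hAdef]; ring
  have hG' : ∀ (μ₀ : Fin (3 + 1)) (z₀ : Site (3 + 1)) (s : ℕ), s ≤ n → ∀ u : Site (3 + 1),
      |Gp' μ₀ z₀ s (blk (Lc ^ s) u)| ≤ (A * C₁ * ((Lc : ℝ) ^ (5 * (n + 1)))⁻¹) * (Lc : ℝ) ^ s * Real.exp (-(min δK κ₁ * supNorm (quo (Lc ^ (n + 1)) u - z₀))) := by
    intro μ₀ z₀ s hs u
    rw [hGp'def, ← eA1]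
    refine hmerge G1' _ μ₀ z₀ (by positivity) (fun s' hs' y => ?_) s hs u
    have h := abs_combGaugePiece_le (Lc := Lc) hκ₁.le hC₁ hN1 hr hrl hF (i + 1) n μ₀ z₀ hs' y
    rw [hG1'def]; exact h
  have hG : ∀ (μ₀ : Fin (3 + 1)) (z₀ : Site (3 + 1)) (s : ℕ), s ≤ n → ∀ u : Site (3 + 1),
      |Gp μ₀ z₀ s (blk (Lc ^ s) u)| ≤ (A * C₁ * ((Lc : ℝ) ^ (5 * (n + 1)))⁻¹) * (Lc : ℝ) ^ s * Real.exp (-(min δK κ₁ * supNorm (quo (Lc ^ (n + 1)) u - z₀))) := by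
    intro μ₀ z₀ s hs u
    rw [hGpdef, ← eA1]
    refine hmerge G1 _ μ₀ z₀ (by positivity) (fun s' hs' y => ?_) s hs u
    have h := abs_combGaugePiece_le (Lc := Lc) hκ₁.le hC₁ hN1 hr hrl hF i n μ₀ z₀ hs' y
    rw [hG1def]; exact h
  have hGΔ : ∀ (μ₀ : Fin (3 + 1)) (z₀ : Site (3 + 1)) (s : ℕ), s ≤ n → ∀ u : Site (3 + 1),
      |GΔ μ₀ z₀ s (blk (Lc ^ s) u)| ≤ (A * (cC * θ ^ (i + n)) * ((Lc : ℝ) ^ (5 * (n + 1)))⁻¹) * (Lc : ℝ) ^ s *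
        Real.exp (-(min δK κ₁ * supNorm (quo (Lc ^ (n + 1)) u - z₀))) := by
    intro μ₀ z₀ s hs u
    rw [hGΔdef, ← eAΔ]
    refine hmerge D1 _ μ₀ z₀ (by positivity) (fun s' hs' y => ?_) s hs u
    have h := abs_combPieceSucc_le (Lc := Lc) hκ₁.le hcC hθ hCau hr hrl hF i n μ₀ z₀ hs' y
    rw [hD1def]; exact h
  -- the brackets at the common rate
  have hqi : 0 ≤ ((((Lc : ℝ) ^ n) ^ (2 * 3 + 1))⁻¹) := by positivity
  have hbrK' : ∀ (κ' : Fin (3 + 1)) (u' : Site (3 + 1)) μ y, |∑' u, ∑ l, T' κ' u' l u * c' μ y l u|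
      ≤ (Tb * ((((Lc : ℝ) ^ n) ^ (2 * 3 + 1))⁻¹)) * Real.exp (-(min δK κ₁ * supNorm (quo (Lc ^ n) y - u'))) := fun κ' u' μ y =>
    (hbr' κ' u' μ y).trans (mul_le_mul_of_nonneg_left (exp_env_mono_rate hκK (supNorm_nonneg _)) (by positivity))
  have hbrK : ∀ (κ' : Fin (3 + 1)) (u' : Site (3 + 1)) μ y, |∑' u, ∑ l, T κ' u' l u * c μ y l u|
      ≤ (Tb * ((((Lc : ℝ) ^ n) ^ (2 * 3 + 1))⁻¹)) * Real.exp (-(min δK κ₁ * supNorm (quo (Lc ^ n) y - u'))) := fun κ' u' μ y =>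
    (hbr κ' u' μ y).trans (mul_le_mul_of_nonneg_left (exp_env_mono_rate hκK (supNorm_nonneg _)) (by positivity))
  have hbrKΔ : ∀ (κ' : Fin (3 + 1)) (u' : Site (3 + 1)) μ y,
      |(∑' u, ∑ l, T' κ' u' l u * c' μ y l u) - ∑' u, ∑ l, T κ' u' l u * c μ y l u|
        ≤ (TΔ * θ ^ (i + n) * ((((Lc : ℝ) ^ n) ^ (2 * 3 + 1))⁻¹)) * Real.exp (-(min δK κ₁ * supNorm (quo (Lc ^ n) y - u'))) := fun κ' u' μ y =>
    (hbrΔ κ' u' μ y).trans (mul_le_mul_of_nonneg_left (exp_env_mono_rate hκK (supNorm_nonneg _)) (by positivity))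
  -- the `inl∕inl` block by D2c; the others vanish
  have hS1 := isFF_push₃ (l := T') (r := T') (w := T') (SLam Lc c' (fun μ y => symHessFFAt (toSite rt) Lc μ y)) κ' u'
  have hS1' := isFF_push₃ (l := B') (r := B') (w := B') (SLam Lc c' (fun μ y => symHessFFAt (toSite rt) Lc μ y)) κ' u'
  have hS0 := isFF_push₃ (l := T) (r := T) (w := T) (SLam Lc c (fun μ y => symHessFFAt (toSite rt) Lc μ y)) κ' u'
  have hS0' := isFF_push₃ (l := B) (r := B) (w := B) (SLam Lc c (fun μ y => symHessFFAt (toSite rt) Lc μ y)) κ' u'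
  have hZ : 0 ≤ Zl (3 + 1) (min δK κ₁ / (4 * ((3 : ℝ) + 1))) := Zl_nonneg (by positivity)
  have hRHS0 : 0 ≤ ((Lc : ℝ) ^ 3 * ((2 * ((((3 + 1).factorial : ℕ) : ℝ) * (Lc : ℝ) ^ (3 + 1)))⁻¹ * ((((3 : ℝ) + 1) * (Real.exp (2 * ((3 : ℝ) + 1) * min δK κ₁) ^ 2 *
              (((2 * Lc : ℕ) : ℝ) ^ (3 + 1) * (((3 + 1 : ℕ) : ℝ) * ((((3 + 1).factorial : ℕ) : ℝ) * ((Lc : ℝ) ^ (3 + 1) * (ell (3 + 1) Lc : ℝ))))))))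
            * (C₁ * (TΔ * C₁ + 2 * Tb * cC)) * (8 * A + 8 * A ^ 2 + 4 * A * Lc + 12 * A ^ 2 * Lc) * Zl (3 + 1) (min δK κ₁ / (4 * ((3 : ℝ) + 1)))))
          * ((((n : ℝ) + 1)) * ((Lc : ℝ)⁻¹) ^ (n + 1)) * θ ^ (i + n)
          * Real.exp (-(min δK κ₁ / 12) * (supNorm (x - u') + supNorm (z - u'))) := by positivity
  rcases a with α | μa
  · rcases b with β | νb
    · have hmain := abs_contactPair_entry_le (d := 3) (Lc := Lc) (rr := rt) (n := n) (κ := min δK κ₁)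
        (αg' := A * C₁ * ((Lc : ℝ) ^ (5 * (n + 1)))⁻¹) (αg := A * C₁ * ((Lc : ℝ) ^ (5 * (n + 1)))⁻¹)
        (αΔ := A * (cC * θ ^ (i + n)) * ((Lc : ℝ) ^ (5 * (n + 1)))⁻¹)
        (KB' := C₁ * ((Lc : ℝ) ^ (5 * (n + 1)))⁻¹) (KB := C₁ * ((Lc : ℝ) ^ (5 * (n + 1)))⁻¹) (KΔ := cC * θ ^ (i + n) * ((Lc : ℝ) ^ (5 * (n + 1)))⁻¹)
        (Tb' := Tb * ((((Lc : ℝ) ^ n) ^ (2 * 3 + 1))⁻¹)) (Tb := Tb * ((((Lc : ℝ) ^ n) ^ (2 * 3 + 1))⁻¹))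
        (TbΔ := TΔ * θ ^ (i + n) * ((((Lc : ℝ) ^ n) ^ (2 * 3 + 1))⁻¹))
        (T' := T') (B' := B') (T := T) (B := B) (lam' := lam') (lam := lam) (G' := Gp') (G := Gp) (GΔ := GΔ) (c' := c') (c := c)
        hLc1 hrt hκ (by positivity) (by positivity) (by positivity) (by positivity) (by positivity) (by positivity) (by positivity) (by positivity)
        (by positivity)
        hc' hδc' hCc' hdiv' hT' hTs' hBn' hTB' hlamB' hψ' hG' hbrK'
        hc hδc hCc hdiv hT hTs hBn hTB hlamB hψ hG hbrK
        hψΔ hGΔ hBΔ hbrKΔ κ' u' x z α β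
      rw [← mul_sub, abs_mul, abs_pow]
      have hw0 : 0 ≤ |cE * (Lc : ℝ) ^ (2 * (3 + 1))| ^ (n + 1) := pow_nonneg (abs_nonneg _) _
      refine (mul_le_mul_of_nonneg_left hmain hw0).trans ?_
      have hP := polyA_le' (Lc := Lc) hA0 n
      have hU := units_le (Lc := Lc) hcE n
      -- names
      set E2C : ℝ := Real.exp (2 * ((3 : ℝ) + 1) * min δK κ₁) ^ 2 *
          (((2 * Lc : ℕ) : ℝ) ^ (3 + 1) * (((3 + 1 : ℕ) : ℝ) * ((((3 + 1).factorial : ℕ) : ℝ) * ((Lc : ℝ) ^ (3 + 1) * (ell (3 + 1) Lc : ℝ))))) with hE2C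
      set Zc : ℝ := Zl (3 + 1) (min δK κ₁ / (4 * ((3 : ℝ) + 1))) with hZdef
      set W : ℝ := |cE * (Lc : ℝ) ^ (2 * (3 + 1))| ^ (n + 1) with hWdef
      set EX : ℝ := Real.exp (-(min δK κ₁ / 12) * (supNorm (x - u') + supNorm (z - u'))) with hEX
      set Xi : ℝ := ((Lc : ℝ) ^ (5 * (n + 1)))⁻¹ with hXi
      set qi : ℝ := ((((Lc : ℝ) ^ n) ^ (2 * 3 + 1))⁻¹) with hqidef
      set Q4 : ℝ := (((Lc ^ n : ℕ) : ℝ)) ^ (3 + 1) with hQ4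
      set θp : ℝ := θ ^ (i + n) with hθpdef
      set P0 : ℝ := C₁ * (TΔ * C₁ + 2 * Tb * cC) with hP0
      set PL : ℝ := (8 * A + 8 * A ^ 2 + 4 * A * Lc + 12 * A ^ 2 * Lc) with hPL
      have hE0 : 0 ≤ E2C := by positivity
      have hW0 : 0 ≤ W := hw0
      have hEX0 : 0 ≤ EX := (Real.exp_pos _).le
      have hXi0 : 0 ≤ Xi := by positivity
      have hP00 : 0 ≤ P0 := by positivity
      have hθp0 : 0 ≤ θp := hθp
      have hqi0 : 0 ≤ qi := hqi
      have hQ40 : 0 ≤ Q4 := by positivity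
      have hPL0 : 0 ≤ PL := by positivity
      have hZc0 : 0 ≤ Zc := hZ
      clear_value E2C Zc W EX Xi qi Q4 θp P0 PL
      -- the three cell-pair polynomials are `θp·qi·Xi²·P0·(64Lc + 512Lc² + (32Lc² + 768Lc³)·n)` exactly
      have hpoly :
          ((TΔ * θp * qi) * (C₁ * Xi) * (4 * (A * C₁ * Xi) + 2 * (A * C₁ * Xi) * Lc * n)
              + (Tb * qi) * (C₁ * Xi) * (4 * (A * (cC * θp) * Xi) + 2 * (A * (cC * θp) * Xi) * Lc * n)
              + (Tb * qi) * (cC * θp * Xi) * (4 * (A * C₁ * Xi) + 2 * (A * C₁ * Xi) * Lc * n))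
            + ((TΔ * θp * qi) * (8 * ((A * C₁ * Xi) * (A * C₁ * Xi)) + 2 * (6 * ((A * C₁ * Xi) * (A * C₁ * Xi))) * Lc * n)
              + (Tb * qi) * (8 * ((A * (cC * θp) * Xi) * (A * C₁ * Xi)) + 2 * (6 * ((A * (cC * θp) * Xi) * (A * C₁ * Xi))) * Lc * n)
              + (Tb * qi) * (8 * ((A * C₁ * Xi) * (A * (cC * θp) * Xi)) + 2 * (6 * ((A * C₁ * Xi) * (A * (cC * θp) * Xi))) * Lc * n))
            + ((TΔ * θp * qi) * (C₁ * Xi) * (4 * (A * C₁ * Xi) + 2 * (A * C₁ * Xi) * Lc * n)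
              + (Tb * qi) * (C₁ * Xi) * (4 * (A * (cC * θp) * Xi) + 2 * (A * (cC * θp) * Xi) * Lc * n)
              + (Tb * qi) * (cC * θp * Xi) * (4 * (A * C₁ * Xi) + 2 * (A * C₁ * Xi) * Lc * n))
          = θp * qi * Xi ^ 2 * P0 * (8 * A + 8 * A ^ 2 + (4 * A * Lc + 12 * A ^ 2 * Lc) * n) := by
        rw [hP0]; ring
      -- regroup: W·(w·(4·E2C·(M+D+M)·(Q4·Zc)·EX)) = (W·(qi·(Xi²·Q4)))·((w·(4·E2C)·P0·Zc)·poly·θp·EX)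
      have step1 : W * ((2 * ((((3 + 1).factorial : ℕ) : ℝ) * (Lc : ℝ) ^ (3 + 1)))⁻¹ * ((((3 : ℝ) + 1) * E2C)
            * (θp * qi * Xi ^ 2 * P0 * (8 * A + 8 * A ^ 2 + (4 * A * Lc + 12 * A ^ 2 * Lc) * n))
            * (Q4 * Zc) * EX))
          ≤ W * ((2 * ((((3 + 1).factorial : ℕ) : ℝ) * (Lc : ℝ) ^ (3 + 1)))⁻¹ * ((((3 : ℝ) + 1) * E2C)
            * (θp * qi * Xi ^ 2 * P0 * (((n : ℝ) + 1) * PL))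
            * (Q4 * Zc) * EX)) := by
        refine mul_le_mul_of_nonneg_left (mul_le_mul_of_nonneg_left ?_ (by positivity)) hW0
        have h1 : 0 ≤ ((3 : ℝ) + 1) * E2C := by positivity
        have h2 : 0 ≤ Q4 * Zc := by positivity
        have h3 : 0 ≤ θp * qi * Xi ^ 2 * P0 := by positivity
        have h4 : θp * qi * Xi ^ 2 * P0 * (8 * A + 8 * A ^ 2 + (4 * A * Lc + 12 * A ^ 2 * Lc) * n)
            ≤ θp * qi * Xi ^ 2 * P0 * (((n : ℝ) + 1) * PL) := mul_le_mul_of_nonneg_left hP h3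
        gcongr
      refine (le_of_eq ?_).trans (step1.trans ?_)
      · rw [← hpoly, hE2C, hZdef, hEX, hqidef, hXi, hθpdef, hQ4]; ring
      · have hR0 : 0 ≤ ((2 * ((((3 + 1).factorial : ℕ) : ℝ) * (Lc : ℝ) ^ (3 + 1)))⁻¹ * ((((3 : ℝ) + 1) * E2C) * P0 * PL * Zc)) * (((n : ℝ) + 1)) * θp * EX := by positivity
        calc W * ((2 * ((((3 + 1).factorial : ℕ) : ℝ) * (Lc : ℝ) ^ (3 + 1)))⁻¹ * ((((3 : ℝ) + 1) * E2C) * (θp * qi * Xi ^ 2 * P0 * (((n : ℝ) + 1) * PL)) * (Q4 * Zc) * EX))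
            = (W * (qi * (Xi ^ 2 * Q4))) * (((2 * ((((3 + 1).factorial : ℕ) : ℝ) * (Lc : ℝ) ^ (3 + 1)))⁻¹ * ((((3 : ℝ) + 1) * E2C) * P0 * PL * Zc)) * (((n : ℝ) + 1)) * θp * EX) := by
              ring
          _ ≤ ((Lc : ℝ) ^ 3 * ((Lc : ℝ)⁻¹) ^ (n + 1))
              * (((2 * ((((3 + 1).factorial : ℕ) : ℝ) * (Lc : ℝ) ^ (3 + 1)))⁻¹ * ((((3 : ℝ) + 1) * E2C) * P0 * PL * Zc)) * (((n : ℝ) + 1)) * θp * EX) := by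
              refine mul_le_mul_of_nonneg_right ?_ hR0
              exact hU
          _ = _ := by rw [hE2C, hZdef, hEX, hθpdef, hP0, hPL]; ring
    · rw [hS1.2 x z (Sum.inl α) νb, hS1'.2 x z (Sum.inl α) νb, hS0.2 x z (Sum.inl α) νb, hS0'.2 x z (Sum.inl α) νb]
      simp only [sub_self, mul_zero, abs_zero]
      exact hRHS0
  · rw [hS1.1 x z μa b, hS1'.1 x z μa b, hS0.1 x z μa b, hS0'.1 x z μa b]
    simp only [sub_self, mul_zero, abs_zero]
    exact hRHS0

end Pair

end Summit.QuantumFields.BalabanUV.Beta.GAN24.CombBornLambdaContactPairLineage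

end
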